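import Mathlib
import Summits.ValiantsHypothesis.ValiantsHypothesis.Theorems.DivisionGapPerMultiplesHardRichFacesDeep
import Summits.ValiantsHypothesis.ValiantsHypothesis.Theorems.DivisionGapPerMultiplesHardStubTypedDecompositionLL
import Summits.ValiantsHypothesis.ValiantsHypothesis.Theorems.DivisionGapPerMultiplesHardStubSharpChoose
import Summits.ValiantsHypothesis.ValiantsHypothesis.Theorems.DivisionGapPerMultiplesHardStubBoardCompression
import Literature.Barriers.ValiantsHypothesis.MonotoneGapParseTrees
import Literature.Computability.AlgebraicComplexity.ArithCircuitProofs
import Literature.Computability.AlgebraicComplexity.PermanentIrreducible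

/-!
# `DivisionGap.PerMultiplesHard` (stmt-ValiantsHypothesis-5068), line `uncharged-face-walk`:
the TWO-SIDED deep richness engine (stub `richFacesDeep2`)

For `n ≥ 9` and every set of cells `G ⊆ [n]²`, the face permanent
`per_G := Σ_{σ ⊆ G} x^{μ_σ}` satisfies, with `L := L⁺(per_G)` (the tree's monotone fan-in-two
`complexity` over `ℝ≥0`),

  `#PM(G) · 3^n · 3^n ≤ L² · (8L + 8) · n! · (n+1)³ · 2^{n - ⌊n/3⌋} · 2^{n - ⌊n/3⌋ + 1}`.

This is the assembly of `RichFacesDeep.richFacesDeep` (one-sided, p110925) with BOTH factors of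
every term counted sharply:
1. `TypedDecompositionLL.stub_typedDecompositionLL` (`D = 3`): `per_G = Σ_{t<s} a_t b_t`, `s ≤ L`,
   `L(a_t) ≤ L`, `L(b_t) ≤ 8L + 8`, `a_t` typed `(ρ, γ)` with `n < 3k ≤ 2n`, `k = #{ρ ≠ 0}`
   (so `k ≥ 4` and `n - k ≥ 3`).
2. Per term: the unit margins of `a_t b_t` split into complementary `0/1` margins
   (`RichFacesDeep.margins_split`); the deep factor bound
   `RichFacesDeep.card_support_typed_factor_le` on BOTH sides gives
   `#supp a_t · 3^k ≤ (k+1) 2^{k-⌊k/3⌋} L k!` and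
   `#supp b_t · 3^{n-k} ≤ (n-k+1) 2^{(n-k)-⌊(n-k)/3⌋} (8L+8) (n-k)!`; multiply, use
   `3^n ≤ (n+1) C(n,k) 2^{n-⌊n/3⌋}` (`SharpChoose.stub_sharpChoose`), `C(n,k) k! (n-k)! = n!`,
   `(k+1), (n-k+1) ≤ n+1` and `(k-⌊k/3⌋) + ((n-k)-⌊(n-k)/3⌋) ≤ n - ⌊n/3⌋ + 1`.
3. Sum over the `s ≤ L` terms (`support_sum`, `card_biUnion_le`). [cite: JerrumSnir1982, §3–§4.3]
-/

noncomputable section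

set_option linter.dupNamespace false

open MvPolynomial Literature.Computability.AlgebraicComplexity
open scoped NNReal BigOperators
open Literature.Barriers.ValiantsHypothesis
open Summit.ValiantsHypothesis.ValiantsHypothesis.Theorems.DivisionGap.PerMultiplesHard

namespace Summit.ValiantsHypothesis.ValiantsHypothesis.Theorems.DivisionGap.PerMultiplesHard.RichFacesDeep2

section Factors

variable {n k : ℕ}

/-- **The two-sided deep bound for a typed product with complementary `0/1` margins.**  For
`n ≥ 9`, `n < 3k ≤ 2n`, `#S = #T = k`, `a` with margins `𝟙_S/𝟙_T` and `L(a) ≤ L`, `b` with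
margins `𝟙_{Sᶜ}/𝟙_{Tᶜ}` and `L(b) ≤ L'`:
`#supp (a b) · 3^n · 3^n ≤ L · L' · n! · (n+1)³ · 2^{n-⌊n/3⌋} · 2^{n-⌊n/3⌋+1}` — from
`#supp (a b) ≤ #supp a · #supp b` (`support_mul_eq`), the deep factor bound
`card_support_typed_factor_le` on both sides (`k ≥ 3` and `n - k ≥ 3`),
`3^n = 3^k · 3^{n-k} ≤ (n+1) C(n,k) 2^{n-⌊n/3⌋}` (`stub_sharpChoose`), `C(n,k) k! (n-k)! = n!`,
`k+1, n-k+1 ≤ n+1` and `(k-⌊k/3⌋) + ((n-k)-⌊(n-k)/3⌋) ≤ n-⌊n/3⌋+1`.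
[cite: JerrumSnir1982, §3–§4.3] -/
theorem card_support_mul_le_of_margins_two {L L' : ℕ} (hn : 9 ≤ n) (hk1 : n < 3 * k)
    (hk2 : 3 * k ≤ 2 * n) (S T : Finset (Fin n)) (hS : S.card = k) (hT : T.card = k)
    {a b : MvPolynomial (Fin n × Fin n) ℝ≥0}
    (ha : ∀ m ∈ a.support, (∀ i, ∑ j, m (i, j) = if i ∈ S then 1 else 0) ∧
      (∀ j, ∑ i, m (i, j) = if j ∈ T then 1 else 0))
    (hb : ∀ m ∈ b.support, (∀ i, ∑ j, m (i, j) = if i ∈ Sᶜ then 1 else 0) ∧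
      (∀ j, ∑ i, m (i, j) = if j ∈ Tᶜ then 1 else 0))
    (hL : complexity a ≤ L) (hL' : complexity b ≤ L') :
    (a * b).support.card * (3 ^ n * 3 ^ n) ≤
      L * L' * (n.factorial * ((n + 1) ^ 3 * (2 ^ (n - n / 3) * 2 ^ (n - n / 3 + 1)))) := by
  classical
  have hkn : k ≤ n := by omega
  have hA := RichFacesDeep.card_support_typed_factor_le (by omega) S T hS hT a ha
  have hSc : Sᶜ.card = n - k := by rw [Finset.card_compl, Fintype.card_fin, hS]
  have hTc : Tᶜ.card = n - k := by rw [Finset.card_compl, Fintype.card_fin, hT]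
  have hB := RichFacesDeep.card_support_typed_factor_le (k := n - k) (by omega) Sᶜ Tᶜ hSc hTc b hb
  have hAB : (a * b).support.card ≤ a.support.card * b.support.card := by
    rw [JerrumSnir.support_mul_eq]
    exact Finset.card_add_le
  have h3n := SharpChoose.stub_sharpChoose n k hk1 hk2
  have hfact : n.choose k * k.factorial * (n - k).factorial = n.factorial :=
    Nat.choose_mul_factorial_mul_factorial hkn
  have hpow3 : 3 ^ n = 3 ^ k * 3 ^ (n - k) := by rw [← pow_add, Nat.add_sub_of_le hkn]
  have hpow2 : 2 ^ (k - k / 3) * 2 ^ ((n - k) - (n - k) / 3) ≤ 2 ^ (n - n / 3 + 1) := by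
    rw [← pow_add]
    exact Nat.pow_le_pow_right (by norm_num) (by omega)
  have h1 : complexity a * complexity b ≤ L * L' := Nat.mul_le_mul hL hL'
  have h2 : (n + 1) * (k + 1) * (n - k + 1) ≤ (n + 1) * (n + 1) * (n + 1) :=
    Nat.mul_le_mul (Nat.mul_le_mul_left _ (by omega)) (by omega)
  calc (a * b).support.card * (3 ^ n * 3 ^ n)
      = (a * b).support.card * 3 ^ n * (3 ^ k * 3 ^ (n - k)) := by rw [← hpow3]; ring
    _ ≤ a.support.card * b.support.card * ((n + 1) * n.choose k * 2 ^ (n - n / 3)) *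
          (3 ^ k * 3 ^ (n - k)) := Nat.mul_le_mul_right _ (Nat.mul_le_mul hAB h3n)
    _ = a.support.card * 3 ^ k * (b.support.card * 3 ^ (n - k)) *
          ((n + 1) * n.choose k * 2 ^ (n - n / 3)) := by ring
    _ ≤ (k + 1) * 2 ^ (k - k / 3) * (complexity a * k.factorial) *
          ((n - k + 1) * 2 ^ ((n - k) - (n - k) / 3) * (complexity b * (n - k).factorial)) *
          ((n + 1) * n.choose k * 2 ^ (n - n / 3)) :=
        Nat.mul_le_mul_right _ (Nat.mul_le_mul hA hB)
    _ = complexity a * complexity b * (n.choose k * k.factorial * (n - k).factorial) *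
          ((n + 1) * (k + 1) * (n - k + 1)) * 2 ^ (n - n / 3) *
          (2 ^ (k - k / 3) * 2 ^ ((n - k) - (n - k) / 3)) := by ring
    _ ≤ L * L' * n.factorial * ((n + 1) * (n + 1) * (n + 1)) * 2 ^ (n - n / 3) *
          2 ^ (n - n / 3 + 1) := by
        rw [hfact]
        exact Nat.mul_le_mul
          (Nat.mul_le_mul_right _ (Nat.mul_le_mul (Nat.mul_le_mul_right _ h1) h2)) hpow2
    _ = L * L' * (n.factorial * ((n + 1) ^ 3 * (2 ^ (n - n / 3) * 2 ^ (n - n / 3 + 1)))) := by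
        ring

/-- **The two-sided per-term lemma.**  If all monomials of `g` have unit row and column sums,
`supp (a b) ⊆ supp g` (a term of a decomposition of `g` over `ℝ≥0`), `a` is typed with margins
`(ρ, γ)` whose row support `k = #{ρ ≠ 0}` lies in the window `n < 3k ≤ 2n`, `n ≥ 9`,
`L(a) ≤ L` and `L(b) ≤ L'`, then
`#supp (a b) · 3^n · 3^n ≤ L · L' · n! · (n+1)³ · 2^{n-⌊n/3⌋} · 2^{n-⌊n/3⌋+1}`:
trivial if `a = 0` or `b = 0`, else `RichFacesDeep.margins_split` and
`card_support_mul_le_of_margins_two`. [cite: JerrumSnir1982, §3–§4.3] -/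
theorem card_support_mul_typed_le_two {L L' : ℕ} (hn : 9 ≤ n)
    {g a b : MvPolynomial (Fin n × Fin n) ℝ≥0}
    (hg : ∀ m ∈ g.support, (∀ i, ∑ j, m (i, j) = 1) ∧ (∀ j, ∑ i, m (i, j) = 1))
    (hsub : (a * b).support ⊆ g.support) {ρ γ : Fin n → ℕ}
    (ha : ∀ m ∈ a.support, (∀ i, ∑ j, m (i, j) = ρ i) ∧ (∀ j, ∑ i, m (i, j) = γ j))
    (hk1 : n < 3 * (Finset.univ.filter fun i => ρ i ≠ 0).card)
    (hk2 : 3 * (Finset.univ.filter fun i => ρ i ≠ 0).card ≤ 2 * n)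
    (hL : complexity a ≤ L) (hL' : complexity b ≤ L') :
    (a * b).support.card * (3 ^ n * 3 ^ n) ≤
      L * L' * (n.factorial * ((n + 1) ^ 3 * (2 ^ (n - n / 3) * 2 ^ (n - n / 3 + 1)))) := by
  by_cases ha0 : a = 0
  · simp [ha0]
  by_cases hb0 : b = 0
  · simp [hb0]
  obtain ⟨haS, hbS, hTS⟩ :=
    RichFacesDeep.margins_split ha0 hb0 (fun m hm => hg m (hsub hm)) ha
  exact card_support_mul_le_of_margins_two hn hk1 hk2 _ _ rfl hTS haS hbS hL hL'

end Factors

/-- **richFacesDeep2 — the two-sided deep richness engine.**  For `n ≥ 9` and every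
`G ⊆ [n]²`, with `per_G = Σ_{σ ⊆ G} x^{μ_σ}`, `#PM(G)` the number of permutations inside `G` and
`L = L⁺(per_G)`:
`#PM(G) · 3^n · 3^n ≤ L² · (8L + 8) · n! · (n+1)³ · 2^{n-⌊n/3⌋} · 2^{n-⌊n/3⌋+1}`.
Two-sided typed decomposition `per_G = Σ_{t<s} a_t b_t` (`stub_typedDecompositionLL`, `D = 3`,
`s ≤ L`, `L(a_t) ≤ L`, `L(b_t) ≤ 8L + 8`), the per-term lemma `card_support_mul_typed_le_two`,
and `#PM(G) = #supp per_G ≤ Σ_t #supp (a_t b_t)`. [cite: JerrumSnir1982, §3–§4.3] -/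
theorem richFacesDeep2 : ∀ n ≥ 9, ∀ G : Finset (Fin n × Fin n),
    ((Finset.univ : Finset (Equiv.Perm (Fin n))).filter (fun σ => ∀ i, (σ i, i) ∈ G)).card *
        (3 ^ n * 3 ^ n) ≤
      complexity (∑ σ ∈ (Finset.univ : Finset (Equiv.Perm (Fin n))).filter
          (fun σ => ∀ i, (σ i, i) ∈ G), monomial (permMonomial σ) (1 : ℝ≥0)) ^ 2 *
        (8 * complexity (∑ σ ∈ (Finset.univ : Finset (Equiv.Perm (Fin n))).filter
          (fun σ => ∀ i, (σ i, i) ∈ G), monomial (permMonomial σ) (1 : ℝ≥0)) + 8) *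
        (n.factorial * ((n + 1) ^ 3 * (2 ^ (n - n / 3) * 2 ^ (n - n / 3 + 1)))) := by
  intro n hn G
  classical
  set PM := (Finset.univ : Finset (Equiv.Perm (Fin n))).filter (fun σ => ∀ i, (σ i, i) ∈ G)
  set g : MvPolynomial (Fin n × Fin n) ℝ≥0 := ∑ σ ∈ PM, monomial (permMonomial σ) (1 : ℝ≥0)
  set M := n.factorial * ((n + 1) ^ 3 * (2 ^ (n - n / 3) * 2 ^ (n - n / 3 + 1)))
  -- `supp g = μ(PM(G))`: distinct exponents, coefficients `1`
  have hmem : ∀ d, d ∈ g.support ↔ ∃ σ ∈ PM, permMonomial σ = d := fun d =>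
    BoardCompression.mem_support_sum_monomial_iff permMonomial_injective.injOn
      (fun _ _ => one_ne_zero) d
  have hsupp : g.support = PM.image permMonomial := by
    ext d
    rw [hmem, Finset.mem_image]
  have hcard : g.support.card = PM.card := by
    rw [hsupp, Finset.card_image_of_injective _ permMonomial_injective]
  have hg : ∀ m ∈ g.support, (∀ i, ∑ j, m (i, j) = 1) ∧ (∀ j, ∑ i, m (i, j) = 1) := by
    intro m hm
    obtain ⟨σ, -, rfl⟩ := (hmem m).1 hm
    exact ⟨fun i => rowCount_permMonomial σ i, fun j => colCount_permMonomial σ j⟩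
  obtain ⟨s, hsL, a, b, hgab, ht⟩ := TypedDecompositionLL.stub_typedDecompositionLL n 3 le_rfl
    (by omega) g (fun _ => 1) (fun _ => 1) hg (fun _ => one_ne_zero)
  -- every term is bounded by the two-sided per-term lemma
  have hterm : ∀ t, (a t * b t).support.card * (3 ^ n * 3 ^ n) ≤
      complexity g * (8 * complexity g + 8) * M := by
    intro t
    obtain ⟨hLt, hLt', ρ, γ, hty, hk1, hk2⟩ := ht t
    have hsub : (a t * b t).support ⊆ g.support := by
      refine support_subset_of_eq_add (q := ∑ t' ∈ Finset.univ.erase t, a t' * b t') ?_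
      rw [Finset.add_sum_erase _ (fun t' => a t' * b t') (Finset.mem_univ t)]
      exact hgab
    exact card_support_mul_typed_le_two hn hg hsub hty hk1 hk2 hLt hLt'
  -- no cancellation: `#supp g ≤ Σ_t #supp (a_t b_t)`
  have hsum : g.support.card ≤ ∑ t, (a t * b t).support.card := by
    conv_lhs => rw [hgab]
    exact (Finset.card_le_card support_sum).trans Finset.card_biUnion_le
  calc PM.card * (3 ^ n * 3 ^ n)
      = g.support.card * (3 ^ n * 3 ^ n) := by rw [hcard]
    _ ≤ (∑ t, (a t * b t).support.card) * (3 ^ n * 3 ^ n) := Nat.mul_le_mul_right _ hsum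
    _ = ∑ t, (a t * b t).support.card * (3 ^ n * 3 ^ n) := Finset.sum_mul _ _ _
    _ ≤ ∑ _t : Fin s, complexity g * (8 * complexity g + 8) * M :=
        Finset.sum_le_sum fun t _ => hterm t
    _ = s * (complexity g * (8 * complexity g + 8) * M) := by simp
    _ ≤ complexity g * (complexity g * (8 * complexity g + 8) * M) :=
        Nat.mul_le_mul_right _ hsL
    _ = complexity g ^ 2 * (8 * complexity g + 8) * M := by ring

end Summit.ValiantsHypothesis.ValiantsHypothesis.Theorems.DivisionGap.PerMultiplesHard.RichFacesDeep2

end
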